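/-
COR-CM (cell pub-hodgecm2 = stage 2 of the Hodge ladder), seat b26 gen 21 (prover-pub-hodgecm2-b26-g21-0, 2026-08-21);
count-neutral for the binder table (no row).  Lane END-CENTRE: the centre of `End⁰` of a simple abelian
variety is a field (any base field); the centre of `End⁰(X)` as a `ℚ`-ALGEBRA along the isotypic
decomposition; the CM case; `Z(End⁰ X)` is a field iff `X` is isotypic.  Theorems only: no definition,
no named fact.
-/
import Summits.HodgeConjecture.CorCM.EndAlgebraCenterStructure
import Literature.AlgebraicGeometry.Motives.AbelianVarietyEndAlgebraInstances
import HarnessLib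

/-!
# The centre of `End⁰(X)` is `∏ᵢ Z(End⁰ Bᵢ)` — a finite product of fields — along `X ∼ ⨁ᵢ Bᵢ^{nᵢ+1}`

D. Mumford, *Abelian Varieties* (1970), §19: Cor. 2 of Thm. 1 (p. 174) «for `X` simple `End⁰(X)` is a
division ring; for any `X = ∏ X_i^{n_i}` … `End⁰(X) = ⊕ M_{n_i}(D_i)`»; J. S. Milne, *Abelian Varieties*
(Cornell–Silverman 1986) §12 p. 122 «the `r_i` are uniquely determined … each `End⁰(A_i)` is a skew
field»; G. Shimura, *Abelian Varieties with Complex Multiplication and Modular Functions* (1998) §5.1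
Prop. 4 «`K` [the centre of `End_Q(B)`] is the center of `End_Q(A)`» and Prop. 6 (CM case: `End_Q(B) = K`).

Earlier parts of the lineage give `End⁰(⨁ A) ≃ₐ[ℚ] ∏ End⁰(A i)` (orthogonal family), `End⁰(B^m) ≅
Mat_m(End⁰ B)` with `Z(End⁰(B^m)) = diag Z(End⁰ B)`, `End⁰` along isogenies, the isotypic decomposition
and the DIMENSION of the centre (`CorCM/EndAlgebraCenterStructure`).  This file PROVES the algebra form:
* §1 (any field) isogenies are units of `End⁰` (`isUnit_endAlgebra_of_isIsogeny`); `End⁰(B)` of a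
  simple `B` is a division algebra (the tree's `endAlgebra_exists_inv_of_isSimple`, here in `IsUnit`
  form) and **its centre is a field** (`isField_center_endAlgebra_of_isSimple`; the tree had `k = ℂ`).
* §2 (any field) `Z(End⁰(B^m)) ≃ₐ[ℚ] Z(End⁰ B)`, `Z(End⁰(⨁ A)) ≃ₐ[ℚ] ∏ᵢ Z(End⁰(A i))` (orthogonal
  family), `Z(End⁰(⨁ᵢ Bᵢ^{nᵢ+1})) ≃ₐ[ℚ] ∏ᵢ Z(End⁰ Bᵢ)`.
* §3 (alg. closed field) **`Z(End⁰ X) ≃ₐ[ℚ] ∏ᵢ Z(End⁰ Bᵢ)`, a finite product of fields, along the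
  isotypic decomposition of every `X`** (`exists_center_endAlgebra_algEquiv_pi`); `Z(End⁰ X)` is reduced.
* §4 **`Z(End⁰ X)` is a field iff `r = 1` iff `X` is isotypic** (`X ∼ B^{m+1}`, `B` simple): the
  number `r` of isotypic components is an invariant (`isField_center_endAlgebra_iff_eq_one`,
  `isIsogenous_power_iff_eq_one`).
* §5 (over `ℂ`, CM-type) **`Z(End⁰ X) ≃ₐ[ℚ] ∏ᵢ End⁰(Bᵢ)`**, a product of `r` fields of degrees `2 dim Bᵢ`
  (`IsOfCMType.exists_center_algEquiv_pi_endAlgebra`); `Z` a field ⟺ `End⁰ X ⊇` a field of degree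
  `2 dim X` ⟺ `X` isotypic (`IsOfCMType.isField_center_iff_exists_isField_subalgebra`).

## References
* [MumfordAV1970] D. Mumford, *Abelian Varieties* (1970), §19 Thm. 1 Cor. 1–2 (pp. 173–174), Thm. 3,
  Remark p. 169.
* [Milne1986AbelianVarieties] J. S. Milne, *Abelian Varieties*, in Cornell–Silverman (1986), §12 p. 122.
* [Shimura1998] G. Shimura, *Abelian Varieties with Complex Multiplication and Modular Functions*
  (1998), §5.1 Propositions 4 and 6.
-/

noncomputable section

open CategoryTheory CategoryTheory.Limits

namespace Summit.HodgeConjecture.CorCM.CMProductEnd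

open Literature.AlgebraicGeometry.Motives Literature.AlgebraicGeometry.Motives.AbelianVariety
open Literature.AlgebraicGeometry.ComplexMultiplication
open Literature.AlgebraicGeometry.Milne1999 (IsOfCMType IsOfCMTypeSimple)
open Summit.HodgeConjecture.CorCM.AndreRiemann Summit.HodgeConjecture.CorCM.EndAlgebraPower
open Summit.HodgeConjecture.CorCM.IsotypicCM

universe u

/-! ## §1 Any field: isogenies are units of `End⁰`; the centre of `End⁰` of a simple abelian variety is a field -/

section Division

variable {k : Type u} [Field k] {B : AbelianVariety k}

/-- **Isogenies are invertible in `End⁰`**: for an isogeny `f : B → B`, `1 ⊗ f` is a unit of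
`End⁰(B)` with inverse `n⁻¹ (1 ⊗ g)`, `g` the quasi-inverse `f g = g f = [n]`
(`IsIsogeny.exists_nsmul_inverse_holds`). [cite: MumfordAV1970, §19 Remark p. 169] -/
theorem isUnit_endAlgebra_of_isIsogeny {f : B ⟶ B} (hf : IsIsogeny f) :
    IsUnit (endAlgebra.of B (End.of f)) := by
  obtain ⟨g, n, hn, hfg, hgf⟩ := IsIsogeny.exists_nsmul_inverse_holds hf
  have hn' : (n : ℚ) ≠ 0 := Nat.cast_ne_zero.2 hn.ne'
  -- `(1 ⊗ f)(1 ⊗ g) = (1 ⊗ g)(1 ⊗ f) = n`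
  have hmul : ∀ {u v : B ⟶ B}, v ≫ u = n • 𝟙 B →
      endAlgebra.of B (End.of u) * endAlgebra.of B (End.of v) = algebraMap ℚ B.endAlgebra (n : ℚ) := by
    intro u v huv
    rw [← map_mul, show End.of u * End.of v = n • (1 : End B) from huv, map_nsmul, map_one,
      ← Nat.cast_smul_eq_nsmul ℚ, Algebra.algebraMap_eq_smul_one]
  refine isUnit_iff_exists.2
    ⟨algebraMap ℚ B.endAlgebra ((n : ℚ)⁻¹) * endAlgebra.of B (End.of g), ?_, ?_⟩
  · rw [← mul_assoc, ← Algebra.commutes, mul_assoc, hmul hgf, ← map_mul, inv_mul_cancel₀ hn',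
      map_one]
  · rw [mul_assoc, hmul hfg, ← map_mul, inv_mul_cancel₀ hn', map_one]

/-- **`End⁰(B)` of a simple abelian variety is a division algebra** (Mumford §19 Cor. 2 of Thm. 1;
the tree's `endAlgebra_exists_inv_of_isSimple`, any base field), in `IsUnit` form.
[cite: MumfordAV1970, §19 Cor. 2 of Thm. 1 (p. 174)] [cite: Milne1986AbelianVarieties, §12 p. 122] -/
theorem isUnit_endAlgebra_of_isSimple (hB : IsSimple B) {x : B.endAlgebra} (hx : x ≠ 0) : IsUnit x :=
  isUnit_iff_exists.2 (endAlgebra_exists_inv_of_isSimple hB x hx)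

/-- The two-sided inverse of a central unit is central. [folklore] -/
theorem inverse_mem_center {R : Type*} [Ring R] [Algebra ℚ R] {z y : R}
    (hz : z ∈ Subalgebra.center ℚ R) (hzy : z * y = 1) (hyz : y * z = 1) :
    y ∈ Subalgebra.center ℚ R := by
  rw [Subalgebra.mem_center_iff] at hz ⊢
  intro b
  calc b * y = (y * z) * b * y := by rw [hyz, one_mul]
    _ = y * (b * z) * y := by rw [mul_assoc y z b, hz b]
    _ = y * b * (z * y) := by simp only [mul_assoc]
    _ = y * b := by rw [hzy, mul_one]

/-- **The centre of `End⁰(B)` of a simple abelian variety of positive dimension is a field**, over ANY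
base field (the centre of a division ring; the tree's `isField_center_endAlgebra` is the case `k = ℂ`).
[cite: MumfordAV1970, §19 Cor. 2 of Thm. 1 (p. 174)] [cite: Shimura1998, §5.1 Proposition 4] -/
theorem isField_center_endAlgebra_of_isSimple (hB : IsSimple B) (hd : 0 < B.dim) :
    IsField (Subalgebra.center ℚ B.endAlgebra) := by
  haveI := FieldOnPowers.nontrivial_endAlgebra_of_dim_pos hd
  refine ⟨⟨0, 1, fun h => zero_ne_one (congrArg Subtype.val h)⟩, fun x y => mul_comm x y, ?_⟩
  intro z hz
  obtain ⟨y, hzy, hyz⟩ := endAlgebra_exists_inv_of_isSimple hB (z : B.endAlgebra)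
    fun h => hz (Subtype.ext h)
  exact ⟨⟨y, inverse_mem_center z.2 hzy hyz⟩, Subtype.ext hzy⟩

end Division

/-! ## §2 Any field: the centre of `End⁰` of a power, of an orthogonal biproduct, of a biproduct of powers -/

section AnyField

variable {k : Type u} [Field k]

/-- Centres correspond under a `ℚ`-algebra isomorphism, as an isomorphism `Z(R) ≃ₐ[ℚ] Z(S)`
(restriction of `e`). [folklore] -/
theorem nonempty_algEquiv_center_of_algEquiv {R S : Type*} [Ring R] [Ring S] [Algebra ℚ R] [Algebra ℚ S]
    (e : R ≃ₐ[ℚ] S) :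
    ∃ e' : Subalgebra.center ℚ R ≃ₐ[ℚ] Subalgebra.center ℚ S, ∀ z, (e' z : S) = e z :=
  ⟨((Subalgebra.center ℚ R).equivMapOfInjective (e : R →ₐ[ℚ] S) e.injective).trans
      (Subalgebra.equivOfEq _ _ (map_center_algEquiv e)), fun _ => rfl⟩

/-- **`Z(End⁰(B^m)) ≃ₐ[ℚ] Z(End⁰ B)` for `m ≥ 1`**: the centre of `End⁰(B^m) ≅ Mat_m(End⁰ B)` is the
diagonal image of the centre of `End⁰(B)` (`center_endAlgebra_biproduct_eq_map`), and the diagonal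
is injective. [cite: Shimura1998, §5.1 Proposition 4 (proof)] [cite: MumfordAV1970, §19 (p. 174)] -/
theorem nonempty_algEquiv_center_endAlgebra_biproduct {B : AbelianVariety k} {m : ℕ} (hm : 0 < m) :
    ∃ e : Subalgebra.center ℚ B.endAlgebra ≃ₐ[ℚ] Subalgebra.center ℚ (⨁ fun _ : Fin m => B).endAlgebra,
      ∀ c, (e c : (⨁ fun _ : Fin m => B).endAlgebra) = endAlgebra.mapRingHom (diagEnd B m) c :=
  ⟨((Subalgebra.center ℚ B.endAlgebra).equivMapOfInjective _ (mapRingHom_diagEnd_injective hm)).trans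
      (Subalgebra.equivOfEq _ _ center_endAlgebra_biproduct_eq_map.symm), fun _ => rfl⟩

/-- If `End⁰(B)` is commutative, **`Z(End⁰(B^m)) ≃ₐ[ℚ] End⁰(B)`** for `m ≥ 1` (the centre of
`Mat_m(K)` is `K`). [cite: Shimura1998, §5.1 Proposition 4 (proof)] -/
theorem nonempty_algEquiv_center_endAlgebra_biproduct_of_comm {B : AbelianVariety k} {m : ℕ} (hm : 0 < m)
    (hcomm : ∀ x y : B.endAlgebra, x * y = y * x) :
    Nonempty (Subalgebra.center ℚ (⨁ fun _ : Fin m => B).endAlgebra ≃ₐ[ℚ] B.endAlgebra) := by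
  have htop : Subalgebra.center ℚ B.endAlgebra = ⊤ :=
    eq_top_iff.2 fun x _ => Subalgebra.mem_center_iff.2 fun b => hcomm b x
  obtain ⟨e, -⟩ := nonempty_algEquiv_center_endAlgebra_biproduct (B := B) hm
  exact ⟨e.symm.trans ((Subalgebra.equivOfEq _ _ htop).trans Subalgebra.topEquiv)⟩

variable {ι : Type} [Fintype ι] [DecidableEq ι]

/-- **`Z(End⁰(⨁ A)) ≃ₐ[ℚ] ∏ᵢ Z(End⁰(A i))` for an orthogonal family** (`Hom(A j, A l) = 0`, `j ≠ l`):
`End⁰(⨁ A) ≃ₐ[ℚ] ∏ End⁰(A i)` (`nonempty_algEquiv_endAlgebra_biproduct_pi`) and the centre of a product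
is the product of the centres. [cite: MumfordAV1970, §19 (p. 174)] -/
theorem nonempty_algEquiv_center_endAlgebra_biproduct_pi {A : ι → AbelianVariety k}
    (horth : ∀ j l, j ≠ l → ∀ f : A j ⟶ A l, f = 0) :
    Nonempty (Subalgebra.center ℚ (⨁ A).endAlgebra ≃ₐ[ℚ] ∀ i, Subalgebra.center ℚ (A i).endAlgebra) := by
  obtain ⟨e, -⟩ := nonempty_algEquiv_endAlgebra_biproduct_pi horth
  obtain ⟨e', -⟩ := nonempty_algEquiv_center_of_algEquiv e
  obtain ⟨π⟩ := exists_algEquiv_center_pi fun i => (A i).endAlgebra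
  exact ⟨e'.trans π⟩

/-- **`Z(End⁰(⨁ᵢ Bᵢ^{nᵢ+1})) ≃ₐ[ℚ] ∏ᵢ Z(End⁰ Bᵢ)` for an orthogonal family `B`** (Mumford §19 p. 174
with Shimura's «the centre of `End_Q(B)` is the centre of `End_Q(B × ⋯ × B)`»).
[cite: MumfordAV1970, §19 (p. 174)] [cite: Shimura1998, §5.1 Proposition 4 (proof)] -/
theorem nonempty_algEquiv_center_endAlgebra_biproduct_powers {B : ι → AbelianVariety k} {n : ι → ℕ}
    (horth : ∀ j l, j ≠ l → ∀ f : B j ⟶ B l, f = 0) :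
    Nonempty (Subalgebra.center ℚ (⨁ fun i => ⨁ fun _ : Fin (n i + 1) => B i).endAlgebra ≃ₐ[ℚ]
      ∀ i, Subalgebra.center ℚ (B i).endAlgebra) := by
  obtain ⟨e⟩ := nonempty_algEquiv_center_endAlgebra_biproduct_pi (orthogonal_biproduct_powers horth (n := n))
  have f : ∀ i, Subalgebra.center ℚ (B i).endAlgebra ≃ₐ[ℚ]
      Subalgebra.center ℚ (⨁ fun _ : Fin (n i + 1) => B i).endAlgebra :=
    fun i => Classical.choose (nonempty_algEquiv_center_endAlgebra_biproduct (B := B i) (Nat.succ_pos (n i)))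
  exact ⟨e.trans (AlgEquiv.piCongrRight fun i => (f i).symm)⟩

end AnyField

/-! ## §3 Algebraically closed field: the centre of `End⁰(X)` along the isotypic decomposition -/

section AlgClosed

variable {k : Type u} [Field k] [IsAlgClosed k]
variable {r : ℕ} {B : Fin r → AbelianVariety k} {n : Fin r → ℕ} {X : AbelianVariety k}

/-- **`Z(End⁰ X) ≃ₐ[ℚ] ∏ᵢ Z(End⁰ Bᵢ)` for `X ∼ ⨁ᵢ Bᵢ^{nᵢ+1}`** with the `Bᵢ` simple and pairwise
non-isogenous (`End⁰` along the isogeny, then §2; pairwise non-isogenous simple abelian varieties are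
orthogonal over an algebraically closed field). [cite: MumfordAV1970, §19 Cor. 2 of Thm. 1 and p. 174]
[cite: Milne1986AbelianVarieties, §12 p. 122] -/
theorem nonempty_algEquiv_center_endAlgebra_of_isIsogenous_powers (hS : ∀ i, (B i).IsSimple)
    (hni : ∀ i j, i ≠ j → ¬ IsIsogenous (B i) (B j))
    (hX : IsIsogenous X (⨁ fun i => ⨁ fun _ : Fin (n i + 1) => B i)) :
    Nonempty (Subalgebra.center ℚ X.endAlgebra ≃ₐ[ℚ] ∀ i, Subalgebra.center ℚ (B i).endAlgebra) := by
  obtain ⟨e⟩ := hX.nonempty_endAlgebra_algEquiv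
  obtain ⟨e', -⟩ := nonempty_algEquiv_center_of_algEquiv e
  obtain ⟨e''⟩ := nonempty_algEquiv_center_endAlgebra_biproduct_powers (n := n)
    (orthogonal_of_isSimple_of_not_isIsogenous hS hni)
  exact ⟨e'.trans e''⟩

variable (X) in
/-- **The centre of `End⁰(X)` for every abelian variety over an algebraically closed field**
(Mumford §19 Cor. 1–2 of Thm. 1, p. 174; Milne §12 p. 122): along the isotypic decomposition
`X ∼ ⨁ᵢ Bᵢ^{nᵢ+1}` (`Bᵢ` simple, `dim Bᵢ > 0`, pairwise non-isogenous) the centre `Z(End⁰ X)` is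
`≃ₐ[ℚ] ∏ᵢ Z(End⁰ Bᵢ)`, a finite product of FIELDS (the centres of the division algebras `End⁰ Bᵢ`).
[cite: MumfordAV1970, §19 Cor. 1–2 of Thm. 1 (pp. 173–174)] [cite: Milne1986AbelianVarieties, §12 p. 122] -/
theorem exists_center_endAlgebra_algEquiv_pi :
    ∃ (r : ℕ) (B : Fin r → AbelianVariety k) (n : Fin r → ℕ),
      (∀ i, (B i).IsSimple) ∧ (∀ i, 0 < (B i).dim) ∧ (∀ i j, i ≠ j → ¬ IsIsogenous (B i) (B j)) ∧
      IsIsogenous X (⨁ fun i => ⨁ fun _ : Fin (n i + 1) => B i) ∧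
      Nonempty (Subalgebra.center ℚ X.endAlgebra ≃ₐ[ℚ] ∀ i, Subalgebra.center ℚ (B i).endAlgebra) ∧
      ∀ i, IsField (Subalgebra.center ℚ (B i).endAlgebra) := by
  obtain ⟨r, B, n, hS, hd, hni, hX⟩ := exists_isIsogenous_biproduct_powers_fin X
  exact ⟨r, B, n, hS, hd, hni, hX, nonempty_algEquiv_center_endAlgebra_of_isIsogenous_powers hS hni hX,
    fun i => isField_center_endAlgebra_of_isSimple (hS i) (hd i)⟩

/-- **`Z(End⁰ X)` is reduced** (a finite product of fields has no nilpotents), for every abelian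
variety over an algebraically closed field. [cite: MumfordAV1970, §19 Cor. 2 of Thm. 1 (p. 174)] -/
theorem isReduced_center_endAlgebra (X : AbelianVariety k) : IsReduced (Subalgebra.center ℚ X.endAlgebra) := by
  obtain ⟨r, B, n, hS, hd, -, -, ⟨e⟩, hF⟩ := exists_center_endAlgebra_algEquiv_pi X
  haveI : ∀ i, IsReduced (Subalgebra.center ℚ (B i).endAlgebra) := fun i =>
    letI := (hF i).toField; inferInstance
  haveI : IsReduced (∀ i, Subalgebra.center ℚ (B i).endAlgebra) := inferInstance
  exact isReduced_of_injective e.toRingEquiv.toRingHom e.injective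

end AlgClosed

/-! ## §4 `Z(End⁰ X)` is a field iff `X` is isotypic — the number of isotypic components -/

section Isotypic

/-- **A finite product of fields is a field iff it has exactly one factor.** (Two distinct indices
give the zero divisors `e_i e_j = 0`; no index gives the zero ring.) [folklore] -/
theorem isField_pi_iff_card_eq_one {ι : Type} [Fintype ι] [DecidableEq ι] (R : ι → Type u)
    [∀ i, CommRing (R i)] (hR : ∀ i, IsField (R i)) :
    IsField (∀ i, R i) ↔ Fintype.card ι = 1 := by
  constructor
  · intro hF
    letI := hF.toField
    haveI : ∀ i, Nontrivial (R i) := fun i => letI := (hR i).toField; inferInstance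
    have hne : Nonempty ι := by
      by_contra h
      rw [not_nonempty_iff] at h
      exact hF.exists_pair_ne.elim fun x ⟨y, hxy⟩ => hxy (funext fun i => (h.false i).elim)
    obtain ⟨i₀⟩ := hne
    have hs : ∀ i, (Pi.single i (1 : R i) : ∀ i, R i) ≠ 0 := fun i h =>
      (one_ne_zero (α := R i)) (by simpa using congrFun h i)
    -- at most one index: `e_j e_{i₀} = 0` for `j ≠ i₀` is impossible in a field
    refine Fintype.card_eq_one_iff.2 ⟨i₀, fun j => by_contra fun hj => hs i₀ ?_⟩
    refine (mul_eq_zero.1 (funext fun i => ?_)).resolve_left (hs j)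
    rw [Pi.mul_apply, Pi.zero_apply]
    by_cases hij : i = j
    · subst hij; rw [Pi.single_eq_of_ne hj, mul_zero]
    · rw [Pi.single_eq_of_ne hij, zero_mul]
  · intro h1
    obtain ⟨i₀, hi₀⟩ := Fintype.card_eq_one_iff.1 h1
    haveI : Unique ι := ⟨⟨i₀⟩, hi₀⟩
    letI := (hR default).toField
    exact MulEquiv.isField (Field.toIsField (R default)) (RingEquiv.piUnique R).toMulEquiv

variable {k : Type u} [Field k] {X : AbelianVariety k}

/-- **`Z(End⁰ X)` is a field for an ISOTYPIC abelian variety** `X ∼ B^{m+1}`, `B` simple of positive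
dimension (`Z(Mat(D)) = Z(D)` a field). [cite: Shimura1998, §5.1 Proposition 4]
[cite: MumfordAV1970, §19 Cor. 2 of Thm. 1 (p. 174)] -/
theorem isField_center_endAlgebra_of_isIsogenous_power {B₀ : AbelianVariety k} {m : ℕ} (hB₀ : B₀.IsSimple)
    (hd₀ : 0 < B₀.dim) (hX : IsIsogenous X (⨁ fun _ : Fin (m + 1) => B₀)) :
    IsField (Subalgebra.center ℚ X.endAlgebra) := by
  obtain ⟨e⟩ := hX.nonempty_endAlgebra_algEquiv
  obtain ⟨e₁, -⟩ := nonempty_algEquiv_center_of_algEquiv e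
  obtain ⟨e₂, -⟩ := nonempty_algEquiv_center_endAlgebra_biproduct (B := B₀) (Nat.succ_pos m)
  exact MulEquiv.isField (isField_center_endAlgebra_of_isSimple hB₀ hd₀) (e₁.trans e₂.symm).toMulEquiv

variable [IsAlgClosed k] {r : ℕ} {B : Fin r → AbelianVariety k} {n : Fin r → ℕ}

/-- **`Z(End⁰ X)` is a field iff `X` has exactly ONE isotypic component** (`r = 1` in
`X ∼ ⨁_{i<r} Bᵢ^{nᵢ+1}`, `Bᵢ` simple of positive dimension, pairwise non-isogenous).
[cite: MumfordAV1970, §19 Cor. 1–2 of Thm. 1 (pp. 173–174)] [cite: Milne1986AbelianVarieties, §12 p. 122] -/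
theorem isField_center_endAlgebra_iff_eq_one (hS : ∀ i, (B i).IsSimple) (hd : ∀ i, 0 < (B i).dim)
    (hni : ∀ i j, i ≠ j → ¬ IsIsogenous (B i) (B j))
    (hX : IsIsogenous X (⨁ fun i => ⨁ fun _ : Fin (n i + 1) => B i)) :
    IsField (Subalgebra.center ℚ X.endAlgebra) ↔ r = 1 := by
  obtain ⟨e⟩ := nonempty_algEquiv_center_endAlgebra_of_isIsogenous_powers hS hni hX
  rw [show (r = 1 ↔ Fintype.card (Fin r) = 1) by rw [Fintype.card_fin],
    ← isField_pi_iff_card_eq_one (fun i => Subalgebra.center ℚ (B i).endAlgebra)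
      fun i => isField_center_endAlgebra_of_isSimple (hS i) (hd i)]
  exact ⟨fun h => MulEquiv.isField h e.symm.toMulEquiv, fun h => MulEquiv.isField h e.toMulEquiv⟩

/-- **Uniqueness of the number of isotypic components / characterisation of isotypic abelian
varieties**: given an isotypic decomposition `X ∼ ⨁_{i<r} Bᵢ^{nᵢ+1}`, `X` is isogenous to a power
`B^{m+1}` of a SINGLE simple abelian variety iff `r = 1` (Milne §12: «the `r_i` are uniquely determined
and the `A_i` are uniquely determined up to isogeny»). [cite: Milne1986AbelianVarieties, §12 p. 122 (Prop. 12.1)]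
[cite: MumfordAV1970, §19 Cor. 1 of Thm. 1 (p. 173)] -/
theorem isIsogenous_power_iff_eq_one (hS : ∀ i, (B i).IsSimple) (hd : ∀ i, 0 < (B i).dim)
    (hni : ∀ i j, i ≠ j → ¬ IsIsogenous (B i) (B j))
    (hX : IsIsogenous X (⨁ fun i => ⨁ fun _ : Fin (n i + 1) => B i)) :
    (∃ (B₀ : AbelianVariety k) (m : ℕ), B₀.IsSimple ∧ 0 < B₀.dim ∧
      IsIsogenous X (⨁ fun _ : Fin (m + 1) => B₀)) ↔ r = 1 := by
  constructor
  · rintro ⟨B₀, m, hB₀, hd₀, hX₀⟩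
    exact (isField_center_endAlgebra_iff_eq_one hS hd hni hX).1
      (isField_center_endAlgebra_of_isIsogenous_power hB₀ hd₀ hX₀)
  · intro hr
    subst hr
    refine ⟨B 0, n 0, hS 0, hd 0, hX.trans ?_⟩
    -- `⨁_{Fin 1} (⨁_{Fin (n 0 + 1)} B 0) ≅ ⨁_{Fin (n 0 + 1)} B 0`
    exact ⟨(biproductUniqueIso fun i : Fin 1 => ⨁ fun _ : Fin (n i + 1) => B i).hom,
      isIsogeny_hom_of_iso _⟩

end Isotypic

/-! ## §5 Over `ℂ`, CM-type: the centre is `∏ᵢ End⁰(Bᵢ)`, a product of `r` CM fields -/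

section Complex

/-- If `R` is commutative, `Z(R) ≃ₐ[ℚ] R`. [folklore] -/
theorem nonempty_algEquiv_center_of_comm {R : Type*} [Ring R] [Algebra ℚ R]
    (hcomm : ∀ x y : R, x * y = y * x) : Nonempty (Subalgebra.center ℚ R ≃ₐ[ℚ] R) :=
  ⟨(Subalgebra.equivOfEq _ _
      (eq_top_iff.2 fun x _ => Subalgebra.mem_center_iff.2 fun b => hcomm b x)).trans Subalgebra.topEquiv⟩

variable {r : ℕ} {B : Fin r → AbelianVariety ℂ} {n : Fin r → ℕ} {X : AbelianVariety ℂ}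

/-- **`Z(End⁰ X) ≃ₐ[ℚ] ∏ᵢ End⁰(Bᵢ)` for `X ∼ ⨁ᵢ Bᵢ^{nᵢ+1}` with the `Bᵢ` simple CM and pairwise
non-isogenous** (`End⁰(Bᵢ) = Kᵢ` a field, so `Z(End⁰ Bᵢ) = End⁰ Bᵢ`; Shimura §5.1 Props. 4, 6: the
centre of `End_Q` of an isotypic CM abelian variety `∼ B^h` is `K = End_Q(B)`).
[cite: Shimura1998, §5.1 Propositions 4 and 6] [cite: MumfordAV1970, §19 (p. 174)] -/
theorem nonempty_algEquiv_center_endAlgebra_pi_of_isIsogenous_cmPowers (hS : ∀ i, (B i).IsSimple)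
    (hB : ∀ i, IsOfCMTypeSimple (B i)) (hni : ∀ i j, i ≠ j → ¬ IsIsogenous (B i) (B j))
    (hX : IsIsogenous X (⨁ fun i => ⨁ fun _ : Fin (n i + 1) => B i)) :
    Nonempty (Subalgebra.center ℚ X.endAlgebra ≃ₐ[ℚ] ∀ i, (B i).endAlgebra) := by
  obtain ⟨e⟩ := nonempty_algEquiv_center_endAlgebra_of_isIsogenous_powers hS hni hX
  have f : ∀ i, Subalgebra.center ℚ (B i).endAlgebra ≃ₐ[ℚ] (B i).endAlgebra := fun i =>
    Classical.choice (nonempty_algEquiv_center_of_comm fun x y => (hB i).1.mul_comm x y)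
  exact ⟨e.trans (AlgEquiv.piCongrRight f)⟩

/-- **The centre of `End⁰` of a complex abelian variety of CM-type, as an algebra** (Shimura §5.1
Props. 4 and 6 with Mumford §19 p. 174): in the isotypic decomposition `X ∼ ⨁_{i<r} Bᵢ^{nᵢ+1}` the
`Bᵢ` are simple CM abelian varieties (`End⁰(Bᵢ) = Kᵢ` a (CM) field of degree `2 dim Bᵢ`), pairwise
non-isogenous, and **`Z(End⁰ X) ≃ₐ[ℚ] K₀ × ⋯ × K_{r-1}`**; in particular `dim_ℚ Z(End⁰ X) = Σᵢ 2 dim Bᵢ`.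
[cite: Shimura1998, §5.1 Propositions 4 and 6] [cite: MumfordAV1970, §19 Thm. 1 Cor. 1–2 and p. 174] -/
theorem IsOfCMType.exists_center_algEquiv_pi_endAlgebra (hX : IsOfCMType X) :
    ∃ (r : ℕ) (B : Fin r → AbelianVariety ℂ) (n : Fin r → ℕ),
      (∀ i, (B i).IsSimple) ∧ (∀ i, IsOfCMTypeSimple (B i)) ∧
      (∀ i j, i ≠ j → ¬ IsIsogenous (B i) (B j)) ∧
      IsIsogenous X (⨁ fun i => ⨁ fun _ : Fin (n i + 1) => B i) ∧
      Nonempty (Subalgebra.center ℚ X.endAlgebra ≃ₐ[ℚ] ∀ i, (B i).endAlgebra) ∧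
      (∀ i, IsField (B i).endAlgebra ∧ Module.finrank ℚ (B i).endAlgebra = 2 * (B i).dim) ∧
      Module.finrank ℚ (Subalgebra.center ℚ X.endAlgebra) = ∑ i, 2 * (B i).dim := by
  obtain ⟨r, B, n, hS, hBcm, hni, hXT, -, -, -, -⟩ := IsOfCMType.exists_endAlgebra_structure hX
  exact ⟨r, B, n, hS, hBcm, hni, hXT,
    nonempty_algEquiv_center_endAlgebra_pi_of_isIsogenous_cmPowers hS hBcm hni hXT, fun i => hBcm i,
    finrank_center_endAlgebra_of_isIsogenous_cmPowers hBcm hni hXT⟩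

/-- **For a complex abelian variety of CM-type the following are equivalent: `Z(End⁰ X)` is a field;
`End⁰(X)` contains a field of degree `2 dim X`; `X` is isotypic** (`X ∼ B^{m+1}` with `B` simple) —
read off the isotypic decomposition: all three say `r = 1` (Shimura §5.1 Props. 3–4; the second
equivalence is the lineage's `FieldOnPowers.exists_isField_subalgebra_iff_isotypic`).
[cite: Shimura1998, §5.1 Propositions 3 and 4] [cite: MumfordAV1970, §19 Thm. 1 Cor. 1 (p. 173)] -/
theorem IsOfCMType.isField_center_iff_exists_isField_subalgebra (hX : IsOfCMType X) :
    (IsField (Subalgebra.center ℚ X.endAlgebra) ↔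
        ∃ F : Subalgebra ℚ X.endAlgebra, IsField F ∧ Module.finrank ℚ F = 2 * X.dim) ∧
      (IsField (Subalgebra.center ℚ X.endAlgebra) ↔
        ∃ (B₀ : AbelianVariety ℂ) (m : ℕ), B₀.IsSimple ∧ 0 < B₀.dim ∧
          IsIsogenous X (⨁ fun _ : Fin (m + 1) => B₀)) := by
  obtain ⟨r, B, n, hS, hBcm, hni, hXT, -, -, -, -⟩ := IsOfCMType.exists_endAlgebra_structure hX
  have hd : ∀ i, 0 < (B i).dim := fun i => dim_pos_of_isOfCMTypeSimple (hBcm i)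
  have h1 := isField_center_endAlgebra_iff_eq_one hS hd hni hXT
  have h2 := isIsogenous_power_iff_eq_one hS hd hni hXT
  refine ⟨?_, h1.trans h2.symm⟩
  rw [h1, FieldOnPowers.exists_isField_subalgebra_iff_isotypic, ← h2]
  constructor
  · rintro ⟨B₀, m, hB₀, hd₀, hA⟩
    have hA' : IsIsogenous X (B₀.powSucc m) := hA.trans (isIsogenous_biproduct_powSucc B₀ m)
    -- `B₀` is CM: `X` is, and `B₀` is a direct summand up to isogeny
    have hT : IsOfCMType (⨁ fun _ : Fin (m + 1) => B₀) :=
      (Literature.AlgebraicGeometry.Milne1999.isOfCMType_iff_of_isIsogenous hA).1 hX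
    have hB₀cm : IsOfCMType B₀ := ((isOfCMType_biproduct_fin_iff fun _ : Fin (m + 1) => B₀).1 hT) 0
    refine ⟨B₀, m, hB₀, hd₀, hB₀cm.isOfCMTypeSimple hB₀ hd₀, ?_, hA'⟩
    obtain ⟨u, hu⟩ := hA'
    rw [dim_eq_of_isIsogeny hu, dim_powSucc_eq]
  · rintro ⟨B₀, m, hB₀, hd₀, -, -, hA⟩
    exact ⟨B₀, m, hB₀, hd₀, hA.trans (isIsogenous_biproduct_powSucc B₀ m).symm'⟩

end Complex

end Summit.HodgeConjecture.CorCM.CMProductEnd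

end
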